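import Literature.AlgebraicGeometry.HodgeTheory.MumfordTateRankUnitaryPairDescent
import Literature.AlgebraicGeometry.Motives.HodgeLieTimesCMCurve
import Literature.AlgebraicGeometry.Motives.HodgeThetaAnnihilatorSemisimpleTimesAbelian
import HarnessLib

/-!
# Two unitary summands with NON-RESONANT `Θ`-slopes: the centre of `𝔥(H₁ ⊕ H₂)` is the whole plane `ℚ·ι₁φ₁π₁ ⊕ ℚ·ι₂φ₂π₂`
# (the unitary analogue of Moonen–Zarhin's Lemma (3.4) / Prop. (3.8): the two central tori do not merge when the fields differ)

COR-CM (cell `pub-hodgecm2`, seat `b27` gen 52, count-neutral Mumford–Tate-rank ladder; theorems only, no definition, no named fact; UNCONDITIONAL —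
nothing here uses or asserts HC_CM).  SETTING as in `CorCM/MumfordTateRankUnitaryPairBlocks`: `H = H₁ ⊕ H₂` polarizable of weight `n` with bicone
`ι_i, π_i`, Hodge endomorphisms `φ_i ∈ End_Hdg(H_i)` with `φ_i² = −d_i` (`d_i > 0`), `E_i = ι_iφ_iπ_i`, and (Z): the `ψ`-skew central Hodge endomorphisms
of `H` lie in `ℚE₁ + ℚE₂`.

TRACE TEST.  Write the Hodge operator `Θ ∈ 𝔥(H) ⊗ ℂ` as `Θ = c₁E₁ + c₂E₂ + Θ′`, `Θ′ ∈ [𝔥,𝔥] ⊗ ℂ` (`UnitaryPair.exists_theta_eq_center_add_derived`).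
The functional `Λ_i(Z) = tr((π_i Z ι_i)·φ_i)` kills `[𝔥,𝔥] ⊗ ℂ` (a block of a bracket is a bracket of blocks, which commute with `φ_i`:
`trace_restrict₁_commutator_mul_eq_zero`) and the other corner, so `Λ_i(Θ) = c_i·tr(φ_i²) = −c_i d_i dim V_i`; and `π_iΘι_i = Θ_{H_i}`, so
`Λ_i(Θ) = tr(Θ_{H_i} φ_i) =: σ_i k_i` (for `H_i = H¹` of an abelian variety: `σ_i = i√d_i`, `k_i = 2(n_i′ − n_i″)`,
`HodgeTheory/RankOneCentreTimesCMCurveInvariance`).  Now `ζ = c₁E₁ + c₂E₂ = Θ − Θ′ ∈ (𝔥 ⊗ ℂ) ∩ (ℚE₁ ⊕ ℚE₂) ⊗ ℂ = (𝔥 ∩ (ℚE₁ ⊕ ℚE₂)) ⊗ ℂ`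
(`spanC_inf`).  If `𝔥 ∩ (ℚE₁ ⊕ ℚE₂)` were a proper subspace of the plane it would be a line `ℚ(αE₁ + βE₂)`, whence `c₁β = c₂α` with
`α, β ∈ ℚ`, i.e. `σ₁k₁β d₂ dim V₂ = σ₂k₂α d₁ dim V₁`; squaring (`σ_i² = −d_i`) gives `d₁ = s²d₂` with `s ∈ ℚ` unless `α = β = 0`, which forces
`c₁ = 0`, `σ₁k₁ = 0` — impossible for `k₁ ≠ 0`.  Hence, when `d₁/d₂ ∉ (ℚ^×)²` and `k₁, k₂ ≠ 0`:
* §1 `trace_restrict₁_mul_eq_zero_of_mem_spanC_derived` — `Λ₁` kills `[𝔥,𝔥] ⊗ ℂ`.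
* §2 **`incl_phi_proj_mem_hodgeLie_of_nonresonant`** — `E₁ ∈ 𝔥(H)` and `E₂ ∈ 𝔥(H)`.
Counting (`CorCM/MumfordTateRankUnitaryPairCount`): with both derived corners in `𝔥(H)` (`CorCM/MumfordTateRankUnitaryPairSplitting`) this gives
`dim 𝔥(H) ≥ dim[𝔥₁,𝔥₁] + dim[𝔥₂,𝔥₂] + 2`.  AV reading (`CorCM/MumfordTateRankTypeIVThreefoldPairsExact`): two simple type-IV(2,1) threefolds with NON-isomorphic imaginary quadratic fields have
`t(T × T′) = 8 + 8 + 2 + 1 = 19`.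

## References
* [MoonenZarhin1999LowDim] B. Moonen, Yu. G. Zarhin, *Hodge classes on abelian varieties of low dimension*, Math. Ann. 315 (1999), §2 (2.3), §3 (3.1),
  Lemma (3.4), Prop. (3.8) [corpus: paper:arxiv-math_9901113 pp. 5–7]. [cite: MoonenZarhin1999LowDim, §3 Lemma (3.4) and Prop. (3.8)]
* [Deligne1982HodgeCycles] P. Deligne, *Hodge cycles on abelian varieties*, LNM 900 (1982), I §3 Prop. 3.4, Prop. 3.6. [cite: Deligne1982HodgeCycles, I §3 Prop. 3.6]
* [Humphreys1972] J. E. Humphreys, GTM 9, §5.1 (trace forms), §19.1. [cite: Humphreys1972, §5.1]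

Provenance: Literature home (namespace `Literature.AlgebraicGeometry.HodgeTheory.MumfordTateRank`) of the Summits-side `CorCM/MumfordTateRankUnitaryPairCentre` (cell `pub-hodgecm2`, COR-CM; all its imports are `Literature/`, Mathlib and the already re-homed `MumfordTateRankUnitaryPairDescent`), which `Literature/` may not import; theorems only, no named fact, no definition. Nothing here bears on `HC_CM`. Lane `lit-hodgefound` (Layer A3: CM types, their Kubota ranks and Galois combinatorics), seat p20.
-/

noncomputable section

open scoped TensorProduct

namespace Literature.AlgebraicGeometry.HodgeTheory.MumfordTateRank

namespace UnitaryPair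

open Literature.AlgebraicGeometry.Motives Literature.AlgebraicGeometry.Motives.HodgeStructure Module

universe u

variable {V₁ : Type u} [AddCommGroup V₁] [Module ℚ V₁] [Module.Finite ℚ V₁]
  {V₂ : Type u} [AddCommGroup V₂] [Module ℚ V₂] [Module.Finite ℚ V₂]
  {V : Type u} [AddCommGroup V] [Module ℚ V] [Module.Finite ℚ V] [HodgeTensorFacts.{u, u}] {n : ℤ}
  {H₁ : HodgeStructure V₁ n} {H₂ : HodgeStructure V₂ n} {H : HodgeStructure V n}
  (ι₁ : Hom H₁ H) (π₁ : Hom H H₁) (ι₂ : Hom H₂ H) (π₂ : Hom H H₂)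
  (hπι₁ : ∀ v, π₁.toLinearMap (ι₁.toLinearMap v) = v) (hπι₂ : ∀ v, π₂.toLinearMap (ι₂.toLinearMap v) = v)
  (hsum : ∀ v, ι₁.toLinearMap (π₁.toLinearMap v) + ι₂.toLinearMap (π₂.toLinearMap v) = v)
  {φ₁ : Module.End ℚ V₁} (hφ₁E : φ₁ ∈ H₁.endAlg) {φ₂ : Module.End ℚ V₂} (hφ₂E : φ₂ ∈ H₂.endAlg)

/-! ## §1 The trace functional `Λ₁(Z) = tr((π₁Zι₁)φ₁)` kills `[𝔥,𝔥] ⊗ ℂ` -/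

omit [Module.Finite ℚ V₂] in
include hπι₁ hφ₁E in
/-- **`tr((π₁ Θ′ ι₁)·φ₁) = 0` for `Θ′ ∈ [𝔥(H),𝔥(H)] ⊗ ℂ`**: on a generator `(XY − YX)_ℂ` the block is `(π₁(XY − YX)ι₁)_ℂ`, whose product with `φ₁`
has rational trace `0` (`trace_restrict₁_commutator_mul_eq_zero`: blocks of `𝔥(H)` commute with `φ₁ ∈ End_Hdg(H₁)`), and `tr(T_ℂ) = tr(T)`.
[cite: Humphreys1972, §5.1] [cite: MoonenZarhin1999LowDim, §3 (3.1)] -/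
theorem trace_restrict₁_mul_eq_zero_of_mem_spanC_derived {Θ' : Module.End ℂ (ℂ ⊗[ℚ] V)}
    (hΘ' : Θ' ∈ spanC (Submodule.span ℚ {B | ∃ X ∈ H.hodgeLie, ∃ Y ∈ H.hodgeLie, X * Y - Y * X = B})) :
    LinearMap.trace ℂ _ ((π₁.toLinearMap.baseChange ℂ ∘ₗ Θ' ∘ₗ ι₁.toLinearMap.baseChange ℂ) * φ₁.baseChange ℂ) = 0 := by
  -- the rational functional `B ↦ tr((π₁Bι₁)φ₁)` kills the derived span
  let L : Module.End ℚ V →ₗ[ℚ] ℚ := (LinearMap.trace ℚ V₁) ∘ₗ (LinearMap.mulRight ℚ φ₁) ∘ₗ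
    ((LinearMap.llcomp ℚ V₁ V V₁ π₁.toLinearMap).comp (LinearMap.lcomp ℚ V ι₁.toLinearMap))
  have hL : ∀ B, L B = LinearMap.trace ℚ V₁ ((π₁.toLinearMap ∘ₗ B ∘ₗ ι₁.toLinearMap) * φ₁) := fun B => rfl
  have hLker : Submodule.span ℚ {B | ∃ X ∈ H.hodgeLie, ∃ Y ∈ H.hodgeLie, X * Y - Y * X = B} ≤ LinearMap.ker L := by
    refine Submodule.span_le.2 ?_
    rintro _ ⟨X, hX, Y, hY, rfl⟩
    rw [SetLike.mem_coe, LinearMap.mem_ker, hL]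
    exact trace_restrict₁_commutator_mul_eq_zero ι₁ π₁ hπι₁ hφ₁E hX hY
  -- its complexification kills the complex span
  let LC : Module.End ℂ (ℂ ⊗[ℚ] V) →ₗ[ℂ] ℂ := (LinearMap.trace ℂ (ℂ ⊗[ℚ] V₁)) ∘ₗ (LinearMap.mulRight ℂ (φ₁.baseChange ℂ)) ∘ₗ
    ((LinearMap.llcomp ℂ _ _ _ (π₁.toLinearMap.baseChange ℂ)).comp (LinearMap.lcomp ℂ _ (ι₁.toLinearMap.baseChange ℂ)))
  have hLC : ∀ Z, LC Z = LinearMap.trace ℂ _ ((π₁.toLinearMap.baseChange ℂ ∘ₗ Z ∘ₗ ι₁.toLinearMap.baseChange ℂ) * φ₁.baseChange ℂ) :=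
    fun Z => rfl
  have hker : spanC (Submodule.span ℚ {B | ∃ X ∈ H.hodgeLie, ∃ Y ∈ H.hodgeLie, X * Y - Y * X = B}) ≤ LinearMap.ker LC := by
    refine Submodule.span_le.2 ?_
    rintro _ ⟨B, hB, rfl⟩
    rw [SetLike.mem_coe, LinearMap.mem_ker, hLC, ← LinearMap.baseChange_comp, ← LinearMap.baseChange_comp, ← LinearMap.baseChange_mul,
      LinearMap.trace_baseChange]
    have h : L B = 0 := LinearMap.mem_ker.1 (hLker hB)
    rw [hL] at h
    rw [h, map_zero]
  have h := hker hΘ'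
  rwa [LinearMap.mem_ker, hLC] at h

/-! ## §2 Non-resonant slopes: `E₁, E₂ ∈ 𝔥(H)` -/

section Centre

variable (ψ : H.Polarization)
  (hZ : ∀ z ∈ H.hodgeLie ⊓ Subalgebra.toSubmodule H.endAlg, ∃ x₁ x₂ : ℚ,
      z = x₁ • (ι₁.toLinearMap ∘ₗ φ₁ ∘ₗ π₁.toLinearMap) + x₂ • (ι₂.toLinearMap ∘ₗ φ₂ ∘ₗ π₂.toLinearMap))
  {d₁ : ℚ} (hd₁ : 0 < d₁) (hφ₁2 : φ₁ * φ₁ = -(d₁ • 1)) {d₂ : ℚ} (hd₂ : 0 < d₂) (hφ₂2 : φ₂ * φ₂ = -(d₂ • 1))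
  {σ₁ σ₂ : ℂ} (hσ₁ : σ₁ ^ 2 = -(d₁ : ℂ)) (hσ₂ : σ₂ ^ 2 = -(d₂ : ℂ)) {k₁ k₂ : ℤ} (hk₁ : k₁ ≠ 0) (hk₂ : k₂ ≠ 0)
  (hτ₁ : ∀ Θ₁ : Module.End ℂ (ℂ ⊗[ℚ] V₁), (∀ p, ∀ x ∈ H₁.piece p (n - p), Θ₁ x = ((2 * p - n : ℤ) : ℂ) • x) →
    LinearMap.trace ℂ _ (Θ₁ * φ₁.baseChange ℂ) = σ₁ * k₁)
  (hτ₂ : ∀ Θ₂ : Module.End ℂ (ℂ ⊗[ℚ] V₂), (∀ p, ∀ x ∈ H₂.piece p (n - p), Θ₂ x = ((2 * p - n : ℤ) : ℂ) • x) →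
    LinearMap.trace ℂ _ (Θ₂ * φ₂.baseChange ℂ) = σ₂ * k₂)
  (hfree : ∀ s : ℚ, d₁ ≠ s ^ 2 * d₂)

include hπι₁ hπι₂ hsum hφ₁E hφ₂E ψ hZ hd₁ hφ₁2 hd₂ hφ₂2 hσ₁ hσ₂ hk₁ hk₂ hτ₁ hτ₂ hfree in
set_option maxHeartbeats 800000 in
/-- **Non-resonant `Θ`-slopes put both `E₁ = ι₁φ₁π₁` and `E₂ = ι₂φ₂π₂` in `𝔥(H)`** (the centre of `𝔥(H₁ ⊕ H₂)` is the whole plane `ℚE₁ ⊕ ℚE₂`):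
the trace test of the module docstring — `c_i·tr(φ_i²) = tr(Θ_{H_i}φ_i) = σ_i k_i`, and a central LINE `ℚ(αE₁ + βE₂) ∋ c₁E₁ + c₂E₂` would give
`d₁ = s²d₂`. («If the imaginary quadratic fields are different, the centre of `Hg` is the two-dimensional torus `U_{k₁} × U_{k₂}`».)
[cite: MoonenZarhin1999LowDim, §3 Lemma (3.4) and Prop. (3.8)] [cite: Deligne1982HodgeCycles, I §3 Prop. 3.6] -/
theorem incl_phi_proj_mem_hodgeLie_of_nonresonant :
    ι₁.toLinearMap ∘ₗ φ₁ ∘ₗ π₁.toLinearMap ∈ H.hodgeLie ∧ ι₂.toLinearMap ∘ₗ φ₂ ∘ₗ π₂.toLinearMap ∈ H.hodgeLie := by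
  classical
  obtain ⟨Θ, hΘ⟩ := exists_hodgeTheta H
  have hΘ𝔤 : Θ ∈ spanC H.hodgeLie := (hodgeLieC_eq_spanC H) ▸ H.mem_hodgeLieC_of_forall_piece hΘ
  obtain ⟨c₁, c₂, Θ', hΘ'𝔡, hΘdec⟩ := exists_theta_eq_center_add_derived ι₁ π₁ ι₂ π₂ ψ hZ hΘ𝔤
  haveI : Nontrivial V₁ := by
    by_contra hV
    rw [not_nontrivial_iff_subsingleton] at hV
    obtain ⟨Θ₁, hΘ₁⟩ := exists_hodgeTheta H₁
    have h := hτ₁ Θ₁ hΘ₁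
    have h0 : φ₁ = 0 := Subsingleton.elim _ _
    rw [h0, LinearMap.baseChange_zero, mul_zero, map_zero] at h
    have hσ : σ₁ = 0 := by
      rcases mul_eq_zero.1 h.symm with h' | h'
      · exact h'
      · exact absurd (by exact_mod_cast h') hk₁
    rw [hσ] at hσ₁; have : (d₁ : ℂ) = 0 := by simpa using hσ₁.symm
    exact hd₁.ne' (by exact_mod_cast this)
  haveI : Nontrivial V₂ := by
    by_contra hV
    rw [not_nontrivial_iff_subsingleton] at hV
    obtain ⟨Θ₂, hΘ₂⟩ := exists_hodgeTheta H₂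
    have h := hτ₂ Θ₂ hΘ₂
    have h0 : φ₂ = 0 := Subsingleton.elim _ _
    rw [h0, LinearMap.baseChange_zero, mul_zero, map_zero] at h
    have hσ : σ₂ = 0 := by
      rcases mul_eq_zero.1 h.symm with h' | h'
      · exact h'
      · exact absurd (by exact_mod_cast h') hk₂
    rw [hσ] at hσ₂; have : (d₂ : ℂ) = 0 := by simpa using hσ₂.symm
    exact hd₂.ne' (by exact_mod_cast this)
  -- notation and block plumbing
  set ι₁C := ι₁.toLinearMap.baseChange ℂ with hι₁C
  set π₁C := π₁.toLinearMap.baseChange ℂ with hπ₁C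
  set ι₂C := ι₂.toLinearMap.baseChange ℂ with hι₂C
  set π₂C := π₂.toLinearMap.baseChange ℂ with hπ₂C
  set φ₁C := φ₁.baseChange ℂ with hφ₁C
  set φ₂C := φ₂.baseChange ℂ with hφ₂C
  set E₁ : Module.End ℚ V := ι₁.toLinearMap ∘ₗ φ₁ ∘ₗ π₁.toLinearMap with hE₁
  set E₂ : Module.End ℚ V := ι₂.toLinearMap ∘ₗ φ₂ ∘ₗ π₂.toLinearMap with hE₂
  set 𝔥 := H.hodgeLie with h𝔥def
  set 𝔡 : Submodule ℚ (Module.End ℚ V) := Submodule.span ℚ {B | ∃ X ∈ H.hodgeLie, ∃ Y ∈ H.hodgeLie, X * Y - Y * X = B} with h𝔡def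
  have hπι₁' : π₁.toLinearMap ∘ₗ ι₁.toLinearMap = LinearMap.id := LinearMap.ext hπι₁
  have hπι₂' : π₂.toLinearMap ∘ₗ ι₂.toLinearMap = LinearMap.id := LinearMap.ext hπι₂
  have h11 : ∀ x, π₁C (ι₁C x) = x := fun x => proj_incl_baseChange hπι₁' x
  have h22 : ∀ x, π₂C (ι₂C x) = x := fun x => proj_incl_baseChange hπι₂' x
  have h21 : ∀ x, π₂C (ι₁C x) = 0 := fun x => proj_incl_baseChange_eq_zero (proj₂_comp_incl₁ ι₁ π₁ ι₂ π₂ hπι₁ hπι₂ hsum) x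
  have h12 : ∀ x, π₁C (ι₂C x) = 0 := fun x => proj_incl_baseChange_eq_zero (proj₁_comp_incl₂ ι₁ π₁ ι₂ π₂ hπι₁ hπι₂ hsum) x
  have hE₁C : E₁.baseChange ℂ = ι₁C ∘ₗ φ₁C ∘ₗ π₁C := by rw [hE₁, LinearMap.baseChange_comp, LinearMap.baseChange_comp]
  have hE₂C : E₂.baseChange ℂ = ι₂C ∘ₗ φ₂C ∘ₗ π₂C := by rw [hE₂, LinearMap.baseChange_comp, LinearMap.baseChange_comp]
  have hq : ∀ (q : ℚ) (C : Module.End ℚ V), (q • C).baseChange ℂ = (q : ℂ) • C.baseChange ℂ := fun q C =>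
    TensorProduct.AlgebraTensorModule.ext fun z v => by rw [LinearMap.baseChange_tmul, LinearMap.smul_apply, LinearMap.smul_apply,
      LinearMap.baseChange_tmul, TensorProduct.smul_tmul', ← TensorProduct.smul_tmul, Rat.smul_def, smul_eq_mul]
  have h𝔡𝔥 : 𝔡 ≤ 𝔥 := Submodule.span_le.2 (by rintro _ ⟨X, hX, Y, hY, rfl⟩; exact H.commutator_mem_hodgeLie hX hY)
  -- traces: `tr(φ_i²) = -d_i dim V_i`
  have hν₁ : LinearMap.trace ℂ _ (φ₁C * φ₁C) = -((d₁ : ℂ) * (Module.finrank ℚ V₁ : ℂ)) := by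
    rw [hφ₁C, ← LinearMap.baseChange_mul, LinearMap.trace_baseChange, trace_mul_self_eq_of_sq_eq_neg hφ₁2, eq_ratCast]; push_cast; ring
  have hν₂ : LinearMap.trace ℂ _ (φ₂C * φ₂C) = -((d₂ : ℂ) * (Module.finrank ℚ V₂ : ℂ)) := by
    rw [hφ₂C, ← LinearMap.baseChange_mul, LinearMap.trace_baseChange, trace_mul_self_eq_of_sq_eq_neg hφ₂2, eq_ratCast]; push_cast; ring
  -- the blocks of `Θ` are the Hodge operators of the summands
  have hΘ₁ : ∀ p, ∀ x ∈ H₁.piece p (n - p), (π₁C ∘ₗ Θ ∘ₗ ι₁C) x = ((2 * p - n : ℤ) : ℂ) • x := fun p x hx => by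
    rw [LinearMap.comp_apply, LinearMap.comp_apply, hΘ p (ι₁C x) (ι₁.map_piece_le p _ ⟨x, hx, rfl⟩), map_smul, h11]
  have hΘ₂ : ∀ p, ∀ x ∈ H₂.piece p (n - p), (π₂C ∘ₗ Θ ∘ₗ ι₂C) x = ((2 * p - n : ℤ) : ℂ) • x := fun p x hx => by
    rw [LinearMap.comp_apply, LinearMap.comp_apply, hΘ p (ι₂C x) (ι₂.map_piece_le p _ ⟨x, hx, rfl⟩), map_smul, h22]
  -- the trace functionals applied to the decomposition of `Θ`
  have hr₁E₁ : π₁C ∘ₗ (ι₁C ∘ₗ φ₁C ∘ₗ π₁C) ∘ₗ ι₁C = φ₁C := LinearMap.ext fun x => by simp only [LinearMap.comp_apply, h11]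
  have hr₁E₂ : π₁C ∘ₗ (ι₂C ∘ₗ φ₂C ∘ₗ π₂C) ∘ₗ ι₁C = 0 := LinearMap.ext fun x => by
    simp only [LinearMap.comp_apply, h21, map_zero, LinearMap.zero_apply]
  have hr₂E₂ : π₂C ∘ₗ (ι₂C ∘ₗ φ₂C ∘ₗ π₂C) ∘ₗ ι₂C = φ₂C := LinearMap.ext fun x => by simp only [LinearMap.comp_apply, h22]
  have hr₂E₁ : π₂C ∘ₗ (ι₁C ∘ₗ φ₁C ∘ₗ π₁C) ∘ₗ ι₂C = 0 := LinearMap.ext fun x => by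
    simp only [LinearMap.comp_apply, h12, map_zero, LinearMap.zero_apply]
  have hc₁ : σ₁ * k₁ = c₁ * -((d₁ : ℂ) * (Module.finrank ℚ V₁ : ℂ)) := by
    have hΛ : LinearMap.trace ℂ _ ((π₁C ∘ₗ Θ' ∘ₗ ι₁C) * φ₁C) = 0 := trace_restrict₁_mul_eq_zero_of_mem_spanC_derived ι₁ π₁ hπι₁ hφ₁E hΘ'𝔡
    rw [← hτ₁ _ hΘ₁, ← hν₁]
    conv_lhs => rw [hΘdec]
    simp only [LinearMap.comp_add, LinearMap.add_comp, LinearMap.comp_smul, LinearMap.smul_comp, hr₁E₁, hr₁E₂, smul_zero, add_zero, add_mul,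
      map_add, smul_mul_assoc, map_smul, hΛ, smul_eq_mul]
  have hc₂ : σ₂ * k₂ = c₂ * -((d₂ : ℂ) * (Module.finrank ℚ V₂ : ℂ)) := by
    have hΛ : LinearMap.trace ℂ _ ((π₂C ∘ₗ Θ' ∘ₗ ι₂C) * φ₂C) = 0 := trace_restrict₁_mul_eq_zero_of_mem_spanC_derived ι₂ π₂ hπι₂ hφ₂E hΘ'𝔡
    rw [← hτ₂ _ hΘ₂, ← hν₂]
    conv_lhs => rw [hΘdec]
    simp only [LinearMap.comp_add, LinearMap.add_comp, LinearMap.comp_smul, LinearMap.smul_comp, hr₂E₁, hr₂E₂, smul_zero, zero_add, add_mul,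
      map_add, smul_mul_assoc, map_smul, hΛ, add_zero, smul_eq_mul]
  -- `ζ = c₁E₁ + c₂E₂ ∈ (𝔥 ∩ plane) ⊗ ℂ`
  set S : Submodule ℚ (Module.End ℚ V) := Submodule.span ℚ (({E₁, E₂} : Finset (Module.End ℚ V)) : Set (Module.End ℚ V)) with hSdef
  have hζ𝔥 : c₁ • (ι₁C ∘ₗ φ₁C ∘ₗ π₁C) + c₂ • (ι₂C ∘ₗ φ₂C ∘ₗ π₂C) ∈ spanC (𝔥 ⊓ S) := by
    rw [spanC_inf]
    refine Submodule.mem_inf.2 ⟨?_, ?_⟩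
    · have h : c₁ • (ι₁C ∘ₗ φ₁C ∘ₗ π₁C) + c₂ • (ι₂C ∘ₗ φ₂C ∘ₗ π₂C) = Θ - Θ' := by rw [hΘdec]; abel
      rw [h]
      exact Submodule.sub_mem _ hΘ𝔤 (spanC_mono h𝔡𝔥 hΘ'𝔡)
    · refine Submodule.add_mem _ (Submodule.smul_mem _ _ (Submodule.subset_span ⟨E₁, Submodule.subset_span (by simp), hE₁C⟩))
        (Submodule.smul_mem _ _ (Submodule.subset_span ⟨E₂, Submodule.subset_span (by simp), hE₂C⟩))
  -- if the plane is not inside `𝔥`, `𝔥 ∩ plane` is a line `ℚ(αE₁ + βE₂)`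
  by_contra hnot
  have hlt : 𝔥 ⊓ S < S := by
    refine lt_of_le_of_ne inf_le_right fun heq => hnot ?_
    have hS𝔥 : S ≤ 𝔥 := heq ▸ inf_le_left
    exact ⟨hS𝔥 (Submodule.subset_span (by simp)), hS𝔥 (Submodule.subset_span (by simp))⟩
  have hS2 : Module.finrank ℚ S ≤ 2 := (finrank_span_finset_le_card _).trans Finset.card_le_two
  have h1 : Module.finrank ℚ ↥(𝔥 ⊓ S) ≤ 1 := by
    have h := Submodule.finrank_lt_finrank_of_lt hlt
    omega
  obtain ⟨v, hv⟩ := finrank_le_one_iff.1 h1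
  have hvS : (v : Module.End ℚ V) ∈ Submodule.span ℚ (({E₁, E₂} : Finset (Module.End ℚ V)) : Set (Module.End ℚ V)) :=
    (Submodule.mem_inf.1 v.2).2
  rw [Finset.coe_pair] at hvS
  obtain ⟨α, β, hαβ⟩ := Submodule.mem_span_pair.1 hvS
  -- `ζ = λ (αE₁ + βE₂)_ℂ`
  have hline : spanC (𝔥 ⊓ S) ≤ ℂ ∙ ((v : Module.End ℚ V).baseChange ℂ) := by
    refine Submodule.span_le.2 ?_
    rintro _ ⟨w, hw, rfl⟩
    obtain ⟨c, hc⟩ := hv ⟨w, hw⟩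
    have hc' : w = c • (v : Module.End ℚ V) := by
      have := congrArg Subtype.val hc
      simpa using this.symm
    rw [SetLike.mem_coe]
    dsimp only
    rw [hc', hq]
    exact Submodule.smul_mem _ _ (Submodule.mem_span_singleton_self _)
  obtain ⟨lam, hlam⟩ := Submodule.mem_span_singleton.1 (hline hζ𝔥)
  rw [← hαβ, LinearMap.baseChange_add, hq, hq, hE₁C, hE₂C, smul_add, smul_smul, smul_smul] at hlam
  -- compare blocks: `c₁ = λα`, `c₂ = λβ`
  have hφ₁0 : φ₁C ≠ 0 := fun h0 => by
    have h := hν₁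
    rw [h0, mul_zero, map_zero] at h
    have h' : (d₁ : ℂ) * (Module.finrank ℚ V₁ : ℂ) = 0 := by rw [← neg_eq_zero, ← h]
    rcases mul_eq_zero.1 h' with h'' | h''
    · exact hd₁.ne' (by exact_mod_cast h'')
    · exact Module.finrank_pos.ne' (by exact_mod_cast h'')
  have hφ₂0 : φ₂C ≠ 0 := fun h0 => by
    have h := hν₂
    rw [h0, mul_zero, map_zero] at h
    have h' : (d₂ : ℂ) * (Module.finrank ℚ V₂ : ℂ) = 0 := by rw [← neg_eq_zero, ← h]
    rcases mul_eq_zero.1 h' with h'' | h''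
    · exact hd₂.ne' (by exact_mod_cast h'')
    · exact Module.finrank_pos.ne' (by exact_mod_cast h'')
  have hblk₁ : ∀ a b : ℂ, π₁C ∘ₗ (a • (ι₁C ∘ₗ φ₁C ∘ₗ π₁C) + b • (ι₂C ∘ₗ φ₂C ∘ₗ π₂C)) ∘ₗ ι₁C = a • φ₁C := fun a b => by
    simp only [LinearMap.comp_add, LinearMap.add_comp, LinearMap.comp_smul, LinearMap.smul_comp, hr₁E₁, hr₁E₂, smul_zero, add_zero]
  have hblk₂ : ∀ a b : ℂ, π₂C ∘ₗ (a • (ι₁C ∘ₗ φ₁C ∘ₗ π₁C) + b • (ι₂C ∘ₗ φ₂C ∘ₗ π₂C)) ∘ₗ ι₂C = b • φ₂C := fun a b => by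
    simp only [LinearMap.comp_add, LinearMap.add_comp, LinearMap.comp_smul, LinearMap.smul_comp, hr₂E₁, hr₂E₂, smul_zero, zero_add]
  have hcα : c₁ = lam * (α : ℂ) := by
    have h := congrArg (fun Z => π₁C ∘ₗ Z ∘ₗ ι₁C) hlam
    simp only [hblk₁] at h
    exact (smul_left_injective ℂ hφ₁0 h).symm
  have hcβ : c₂ = lam * (β : ℂ) := by
    have h := congrArg (fun Z => π₂C ∘ₗ Z ∘ₗ ι₂C) hlam
    simp only [hblk₂] at h
    exact (smul_left_injective ℂ hφ₂0 h).symm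
  -- arithmetic: `σ₁k₁ β d₂ N₂ = σ₂k₂ α d₁ N₁`, square it
  have hN₁ : (0 : ℚ) < Module.finrank ℚ V₁ := by exact_mod_cast Module.finrank_pos (R := ℚ) (M := V₁)
  have hN₂ : (0 : ℚ) < Module.finrank ℚ V₂ := by exact_mod_cast Module.finrank_pos (R := ℚ) (M := V₂)
  have hrel : σ₁ * k₁ * ((β * d₂ * Module.finrank ℚ V₂ : ℚ) : ℂ) = σ₂ * k₂ * ((α * d₁ * Module.finrank ℚ V₁ : ℚ) : ℂ) := by
    rw [hc₁, hc₂, hcα, hcβ]; push_cast; ring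
  have hsq : (d₁ : ℂ) * k₁ ^ 2 * ((β * d₂ * Module.finrank ℚ V₂ : ℚ) : ℂ) ^ 2 =
      (d₂ : ℂ) * k₂ ^ 2 * ((α * d₁ * Module.finrank ℚ V₁ : ℚ) : ℂ) ^ 2 := by
    have h := congrArg (fun z => z ^ 2) hrel
    simp only [mul_pow, hσ₁, hσ₂] at h
    linear_combination -h
  have hsqQ : d₁ * (k₁ : ℚ) ^ 2 * (β * d₂ * Module.finrank ℚ V₂) ^ 2 = d₂ * (k₂ : ℚ) ^ 2 * (α * d₁ * Module.finrank ℚ V₁) ^ 2 := by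
    exact_mod_cast hsq
  -- `d₁ d₂ (d₂ (k₁βN₂)² − d₁ (k₂αN₁)²) = 0`
  have hmain : d₂ * ((k₁ : ℚ) * β * Module.finrank ℚ V₂) ^ 2 = d₁ * ((k₂ : ℚ) * α * Module.finrank ℚ V₁) ^ 2 := by
    have h : d₁ * d₂ * (d₂ * ((k₁ : ℚ) * β * Module.finrank ℚ V₂) ^ 2 - d₁ * ((k₂ : ℚ) * α * Module.finrank ℚ V₁) ^ 2) = 0 := by
      linear_combination hsqQ
    rcases mul_eq_zero.1 h with h' | h'
    · exact absurd h' (mul_ne_zero hd₁.ne' hd₂.ne')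
    · exact sub_eq_zero.1 h'
  by_cases hα : α = 0
  · -- then `β = 0`, `ζ = 0`, `σ₁k₁ = 0`
    have hβ : β = 0 := by
      rw [hα, mul_zero, zero_mul, zero_pow two_ne_zero, mul_zero] at hmain
      have h := (mul_eq_zero.1 hmain).resolve_left hd₂.ne'
      rw [sq_eq_zero_iff] at h
      rcases mul_eq_zero.1 h with h' | h'
      · exact (mul_eq_zero.1 h').resolve_left (by exact_mod_cast hk₁)
      · exact absurd h' hN₂.ne'
    have h0 : c₁ = 0 := by rw [hcα, hα, Rat.cast_zero, mul_zero]
    rw [h0, zero_mul] at hc₁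
    rcases mul_eq_zero.1 hc₁ with h' | h'
    · rw [h', zero_pow two_ne_zero] at hσ₁
      have : (d₁ : ℂ) = 0 := by rw [← neg_eq_zero, ← hσ₁]
      exact hd₁.ne' (by exact_mod_cast this)
    · exact hk₁ (by exact_mod_cast h')
  · refine hfree ((k₁ : ℚ) * β * Module.finrank ℚ V₂ / ((k₂ : ℚ) * α * Module.finrank ℚ V₁)) ?_
    have hden : (k₂ : ℚ) * α * Module.finrank ℚ V₁ ≠ 0 := mul_ne_zero (mul_ne_zero (by exact_mod_cast hk₂) hα) hN₁.ne'
    field_simp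
    linear_combination hmain.symm

end Centre

end UnitaryPair

end Literature.AlgebraicGeometry.HodgeTheory.MumfordTateRank

end
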